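import Literature.AnabelianGeometry.SemiGraphs.TreeSystemLevelImageTransportOfSaturated
import Literature.AnabelianGeometry.SemiGraphs.TemperedFirstBranchAtHostOfTopCyclic
import HarnessLib

/-!
# [SemiAnbd] Thm 3.7 (iii) / Cor 3.9 (R3c), ARBITRARY edge groups under SATURATION: the first branch of
# a fixed geodesic reappears, fixed, at the host vertex of every deeper level (proof-only)

Mochizuki, *Semi-graphs of anabelioids*, Publ. RIMS **42** (2006), §3 Theorem 3.7 (iii), proof p. 41,
third paragraph, with the author's *Comments* (2020) (6)(b); Corollary 3.9, proof p. 43 l. 13 (the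
cell's step (R3c), FACT-LIST rows F-2772 `EdgeLikeCentralizerAt` / F-2773 `EdgeLikeCentralizer`)
[cite: MochizukiSemiAnbd2006, Thm 3.7(iii) p.41].

PROOF-ONLY (cell abc-iut, block F, seat abc-iut-f-176 gen 5; the CLASS-FREE form of abc-iut-f-172 gen 7's
file 3/5 `exists_fixed_branch_at_host_of_firstBranch`; no definition, no named fact).  At the canonical
tower of a countable `𝒢` satisfying the hypotheses of Thm. 3.7, let `P` be a compatible point sequence over
`v₀` whose tree vertices are fixed by the subgroup `C` of `π₁^temp(𝒢)` (a HOST), `x` a compatible `C`-fixed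
vertex system, and suppose the geodesic of `𝔾̃_j` from `P.vertex j` to `x_j` starts with the branch `β`.
The class hypothesis «all edge groups topologically cyclic» of the original is replaced by SATURATION AT
LEVEL `n` RELATIVE TO `j`: every `C`-fixed tree edge `ε` of `𝔾̃_n` is saturated — every element of
`Gal(𝒢_{∞,n}/𝒢)` fixing `ε` and trivial in `Gal(𝒢_{∞,j}/𝒢)` lies in `ρ_n(C)` (size reading: the host of
`ε` grows exactly as fast as `C` between levels `j` and `n`).  Conclusion as in the original: the host
vertex `P.vertex n` carries a branch with `C`-fixed edge whose image in `𝔾̃_j` is `β`.  Proof verbatim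
(LAST visit of the image walk of `[P.vertex n, x_n]` to `P.vertex j`; the point of `P.vertex j` separates
`𝔾̃_j`), the transport along the initial segment being the saturated brick
`exists_fixed_branch_of_sameImage_path_of_saturated`.

Honest framing: one sufficient condition; the ∀-closures F-2773 / F-1732 are NOT claimed; nothing here
bears on [IUTchIII] Cor. 3.12; typed ≠ proved elsewhere.
-/

namespace Literature.AnabelianGeometry.SemiGraphs

namespace ProfiniteSemiGraph

open CategoryTheory Topology

universe u

variable (𝒢 : ProfiniteSemiGraph.{u}) (h37 : 𝒢.Thm37Hypotheses)

/-- **A fixed branch with prescribed image at the host, at every deeper level — arbitrary edge groups,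
saturation at level `n` relative to `j`.**  Canonical tower.  Let `P` be a point sequence over `v₀` whose
vertices are `C`-fixed, `x` a compatible `C`-fixed vertex system, and suppose the geodesic of `𝔾̃_j` from
`P.vertex j` to `x_j` starts with the branch `β`; let `j ≤ n` and suppose every `C`-fixed tree edge of
`𝔾̃_n` saturated relative to `j` (every element of `Gal(𝒢_{∞,n}/𝒢)` fixing it and trivial at level `j`
lies in `ρ_n(C)`).  Then `P.vertex n` carries a branch with `C`-fixed edge whose image in `𝔾̃_j` is `β`.
[cite: MochizukiSemiAnbd2006, Thm 3.7(iii) p.41] -/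
theorem exists_fixed_branch_at_host_of_firstBranch_of_saturated
    (C : Subgroup (𝒢.temperedPiChart h37.toProp36Hypotheses).G) {v₀ : 𝒢.graph.Vertex}
    (P : (𝒢.galoisLevelData h37.toProp36Hypotheses).PointSeq h37.toProp36Hypotheses.isCountable v₀)
    (hfP : ∀ g ∈ C, ∀ n, ((𝒢.galoisLevelData h37.toProp36Hypotheses).treeAct
      h37.toProp36Hypotheses.isCountable n g).hom.vertexMap (P.vertex n) = P.vertex n)
    (x : ∀ n, ((𝒢.galoisLevelData h37.toProp36Hypotheses).tree n).Vertex)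
    (hx : ∀ ⦃i n : ℕ⦄ (hin : i ≤ n),
      ((𝒢.galoisLevelData h37.toProp36Hypotheses).treeTrans hin).vertexMap (x n) = x i)
    (hfx : ∀ g ∈ C, ∀ n, ((𝒢.galoisLevelData h37.toProp36Hypotheses).treeAct
      h37.toProp36Hypotheses.isCountable n g).hom.vertexMap (x n) = x n)
    {j : ℕ} (p : ((𝒢.galoisLevelData h37.toProp36Hypotheses).tree j).subdivision.Walk
      (Sum.inl (P.vertex j)) (Sum.inl (x j))) (hp : p.IsPath)
    {β : ((𝒢.galoisLevelData h37.toProp36Hypotheses).tree j).Branch} (hβ : p.getVert 1 = Sum.inr (Sum.inr β))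
    {n : ℕ} (hjn : j ≤ n)
    (hsat : ∀ γ : ((𝒢.galoisLevelData h37.toProp36Hypotheses).tree n).Branch,
      (∀ g ∈ C, ((𝒢.galoisLevelData h37.toProp36Hypotheses).treeAct h37.toProp36Hypotheses.isCountable n g).hom.edgeMap
          (((𝒢.galoisLevelData h37.toProp36Hypotheses).tree n).edgeOf γ) =
        ((𝒢.galoisLevelData h37.toProp36Hypotheses).tree n).edgeOf γ) →
      ∀ q : (𝒢.galoisLevelData h37.toProp36Hypotheses).Gal h37.toProp36Hypotheses.isCountable n,
        (𝒢.galoisLevelData h37.toProp36Hypotheses).mapLE h37.toProp36Hypotheses.isCountable hjn q = 1 →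
        ((𝒢.galoisLevelData h37.toProp36Hypotheses).galTreeAct h37.toProp36Hypotheses.isCountable n q).hom.edgeMap
            (((𝒢.galoisLevelData h37.toProp36Hypotheses).tree n).edgeOf γ) =
          ((𝒢.galoisLevelData h37.toProp36Hypotheses).tree n).edgeOf γ →
        q ∈ C.map ((𝒢.galoisLevelData h37.toProp36Hypotheses).proj h37.toProp36Hypotheses.isCountable n)) :
    ∃ α : ((𝒢.galoisLevelData h37.toProp36Hypotheses).tree n).Branch,
      ((𝒢.galoisLevelData h37.toProp36Hypotheses).tree n).abuts α = some (P.vertex n) ∧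
      ((𝒢.galoisLevelData h37.toProp36Hypotheses).treeTrans hjn).branchMap α = β ∧
      ∀ g ∈ C, ((𝒢.galoisLevelData h37.toProp36Hypotheses).treeAct h37.toProp36Hypotheses.isCountable n g).hom.edgeMap
          (((𝒢.galoisLevelData h37.toProp36Hypotheses).tree n).edgeOf α) =
        ((𝒢.galoisLevelData h37.toProp36Hypotheses).tree n).edgeOf α := by
  classical
  let D := 𝒢.galoisLevelData h37.toProp36Hypotheses
  let hc := h37.toProp36Hypotheses.isCountable
  have hinj := hp.getVert_injOn
  -- `β` abuts `P.vertex j`; `x_j ≠ P.vertex j`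
  have hlen : 0 < p.length := by
    by_contra h
    rw [p.getVert_of_length_le (by omega)] at hβ
    simp at hβ
  have hxa : x j ≠ P.vertex j := by
    intro h
    have h0 : p.getVert p.length = p.getVert 0 := by
      rw [SimpleGraph.Walk.getVert_length, SimpleGraph.Walk.getVert_zero, h]
    have := hinj (by simp) (by simp) h0
    omega
  have h01 := p.adj_getVert_succ (i := 0) hlen
  rw [SimpleGraph.Walk.getVert_zero, Nat.zero_add, hβ] at h01
  have hba : (D.tree j).abuts β = some (P.vertex j) := by
    obtain ⟨b, hba, hbb⟩ := ((D.tree j).subdivision_adj_inl_iff _ _).mp h01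
    have hbβ : b = β := by simpa using hbb.symm
    rw [← hbβ]; exact hba
  -- the level-`n` geodesic `q` from `P.vertex n` to `x_n`, `C`-fixed
  have hT := (D.isTree_tree n).isTree
  let q : (D.tree n).subdivision.Path (Sum.inl (P.vertex n)) (Sum.inl (x n)) := (hT.connected _ _).some.toPath
  have hqfix : ∀ z ∈ q.1.support, ∀ g ∈ C, SemiGraph.nodeMap (D.treeAct hc n g) z = z := by
    intro z hz g hg
    have hv₁ : (D.treeAct hc n g).hom.vertexMap (P.vertex n) = P.vertex n := hfP g hg n
    have hv₂ : (D.treeAct hc n g).hom.vertexMap (x n) = x n := hfx g hg n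
    have h1 : SemiGraph.nodeMap (D.treeAct hc n g) (Sum.inl (P.vertex n)) = Sum.inl (P.vertex n) := by
      simp [hv₁]
    have h2 : SemiGraph.nodeMap (D.treeAct hc n g) (Sum.inl (x n)) = Sum.inl (x n) := by simp [hv₂]
    exact SemiGraph.nodeMap_eq_self_of_isPath hT.isAcyclic _ h1 h2 q.1 q.2 z hz
  have hqfixE : ∀ γ : (D.tree n).Branch, (Sum.inr (Sum.inr γ) : (D.tree n).Node) ∈ q.1.support →
      ∀ g ∈ C, (D.treeAct hc n g).hom.edgeMap ((D.tree n).edgeOf γ) = (D.tree n).edgeOf γ := by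
    intro γ hγ g hg
    have h := hqfix _ hγ g hg
    simp only [SemiGraph.nodeMap_inr_inr, Sum.inr.injEq] at h
    rw [← (D.treeAct hc n g).hom.edgeOf_branchMap γ, h]
  have hqinj := q.2.getVert_injOn
  -- the image walk in `𝔾̃_j`
  let Φ : (D.tree n).subdivision →g (D.tree j).subdivision :=
    ⟨Sum.map (D.treeTrans hjn).vertexMap (Sum.map (D.treeTrans hjn).edgeMap (D.treeTrans hjn).branchMap),
      fun h => SemiGraph.subdivision_adj_map (D.treeTrans hjn) h⟩
  -- the LAST visit of the image walk to `P.vertex j`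
  let Pr : ℕ → Prop := fun i => ∃ s : (D.tree n).Vertex, q.1.getVert i = Sum.inl s ∧
    (D.treeTrans hjn).vertexMap s = P.vertex j
  have hPr0 : Pr 0 := ⟨P.vertex n, SimpleGraph.Walk.getVert_zero _, P.treeTrans_vertex hjn⟩
  set i₁ := Nat.findGreatest Pr q.1.length with hi₁
  have hi₁spec : Pr i₁ := Nat.findGreatest_spec (P := Pr) (Nat.zero_le _) hPr0
  have hi₁le : i₁ ≤ q.1.length := Nat.findGreatest_le _
  have hmax : ∀ k, i₁ < k → k ≤ q.1.length → ¬ Pr k := fun k hk hkl => Nat.findGreatest_is_greatest hk hkl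
  obtain ⟨s, hs, hsimg⟩ := hi₁spec
  have hi₁lt : i₁ < q.1.length := by
    rcases Nat.lt_or_ge i₁ q.1.length with h | h
    · exact h
    · exfalso
      have heq : i₁ = q.1.length := le_antisymm hi₁le h
      rw [heq, SimpleGraph.Walk.getVert_length] at hs
      have hsx : s = x n := (Sum.inl_injective hs).symm
      rw [hsx, hx hjn] at hsimg
      exact hxa hsimg
  -- the next node: a branch `β'` at `s`
  have hadj := q.1.adj_getVert_succ (i := i₁) hi₁lt
  rw [hs] at hadj
  obtain ⟨β', hβ's, hβ'eq⟩ := ((D.tree n).subdivision_adj_inl_iff s _).mp hadj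
  -- KEY: the image of `β'` is `β` (the point of `P.vertex j` separates the tree `𝔾̃_j`)
  have hTj := (D.isTree_tree j).isTree
  have hb₁ : (D.tree j).abuts ((D.treeTrans hjn).branchMap β') = some (P.vertex j) := by
    rw [(D.treeTrans hjn).abuts_branchMap β' s hβ's, hsimg]
  have hkey : (D.treeTrans hjn).branchMap β' = β := by
    -- the image of the tail of `q` after the last visit, followed by `p` reversed up to its first branch
    let W := (q.1.drop (i₁ + 1)).map Φ
    have hW0 : Φ (q.1.getVert (i₁ + 1)) = Sum.inr (Sum.inr ((D.treeTrans hjn).branchMap β')) := by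
      rw [hβ'eq]; rfl
    have hW1 : Φ (Sum.inl (x n)) = Sum.inl (x j) := by
      change Sum.inl ((D.treeTrans hjn).vertexMap (x n)) = Sum.inl (x j)
      rw [hx hjn]
    let W' : (D.tree j).subdivision.Walk (Sum.inr (Sum.inr ((D.treeTrans hjn).branchMap β'))) (Sum.inl (x j)) :=
      W.copy hW0 hW1
    let R : (D.tree j).subdivision.Walk (Sum.inl (x j)) (Sum.inr (Sum.inr β)) := (p.drop 1).reverse.copy rfl hβ
    have havoid : (Sum.inl (P.vertex j) : (D.tree j).Node) ∉ (W'.append R).support := by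
      intro hmem
      rw [SimpleGraph.Walk.mem_support_append_iff] at hmem
      rcases hmem with hmem | hmem
      · -- on the image of the tail: a later visit to `P.vertex j`
        rw [SimpleGraph.Walk.support_copy, SimpleGraph.Walk.support_map, List.mem_map] at hmem
        obtain ⟨z, hz, hzΦ⟩ := hmem
        obtain ⟨m, hm, hmle⟩ := SimpleGraph.Walk.mem_support_iff_exists_getVert.mp hz
        rw [SimpleGraph.Walk.drop_getVert] at hm
        rw [SimpleGraph.Walk.drop_length] at hmle
        have hm' : Sum.map (D.treeTrans hjn).vertexMap
            (Sum.map (D.treeTrans hjn).edgeMap (D.treeTrans hjn).branchMap) (q.1.getVert (i₁ + 1 + m)) =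
              Sum.inl (P.vertex j) := by rw [hm]; exact hzΦ
        rcases hzc : q.1.getVert (i₁ + 1 + m) with s' | e | c
        · rw [hzc] at hm'
          have hs' : (D.treeTrans hjn).vertexMap s' = P.vertex j := Sum.inl_injective hm'
          exact hmax (i₁ + 1 + m) (by omega) (by omega) ⟨s', hzc, hs'⟩
        · rw [hzc] at hm'; simp at hm'
        · rw [hzc] at hm'; simp at hm'
      · -- on `p` after its start: `p` is a path from the point of `P.vertex j`
        rw [SimpleGraph.Walk.support_copy, SimpleGraph.Walk.support_reverse, List.mem_reverse] at hmem
        obtain ⟨m, hm, hmle⟩ := SimpleGraph.Walk.mem_support_iff_exists_getVert.mp hmem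
        rw [SimpleGraph.Walk.drop_getVert] at hm
        rw [SimpleGraph.Walk.drop_length] at hmle
        have h0 : p.getVert (1 + m) = p.getVert 0 := by rw [hm, SimpleGraph.Walk.getVert_zero]
        have := hinj (by simp; omega) (by simp) h0
        omega
    exact SemiGraph.branch_eq_of_walk_avoiding_vertex hTj.isAcyclic hb₁ hba (W'.append R) havoid
  -- the initial segment of `q` up to the last visit: a `C`-fixed path with both ends over `P.vertex j`
  have hsmem : (Sum.inl s : (D.tree n).Node) ∈ q.1.support := by rw [← hs]; exact q.1.getVert_mem_support i₁
  let r := q.1.takeUntil _ hsmem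
  have hr : r.IsPath := q.2.takeUntil hsmem
  have hrfix : ∀ z ∈ r.support, ∀ g ∈ C, SemiGraph.nodeMap (D.treeAct hc n g) z = z :=
    fun z hz => hqfix z (q.1.support_takeUntil_subset_support hsmem hz)
  have haw : (D.treeProj n).vertexMap (P.vertex n) = v₀ := P.treeProj_vertexMap_vertex n
  have haz : (D.treeTrans hjn).vertexMap (P.vertex n) = (D.treeTrans hjn).vertexMap s := by
    rw [P.treeTrans_vertex hjn, hsimg]
  have hβ'mem : (Sum.inr (Sum.inr β') : (D.tree n).Node) ∈ q.1.support := by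
    rw [← hβ'eq]; exact q.1.getVert_mem_support (i₁ + 1)
  have hrsat : ∀ γ : (D.tree n).Branch, (Sum.inr (Sum.inr γ) : (D.tree n).Node) ∈ r.support →
      ∀ q : D.Gal hc n, D.mapLE hc hjn q = 1 →
        (D.galTreeAct hc n q).hom.edgeMap ((D.tree n).edgeOf γ) = (D.tree n).edgeOf γ → q ∈ C.map (D.proj hc n) :=
    fun γ hγ => hsat γ (hqfixE γ (q.1.support_takeUntil_subset_support hsmem hγ))
  obtain ⟨α, hαa, hαimg, hαfix⟩ := D.exists_fixed_branch_of_sameImage_path_of_saturated hc hjn C P haw haz r hr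
    hrfix hrsat β' hβ's (hqfixE β' hβ'mem)
  exact ⟨α, hαa, hαimg.trans hkey, hαfix⟩

end ProfiniteSemiGraph

end Literature.AnabelianGeometry.SemiGraphs
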